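import Summits.QuantumFields.YangMills.Theorems.UnitScaleTiltHalvingHSiteRawP5BaseOfLeaf
import Literature.MathematicalPhysics.QuantumFieldTheory.Balaban1983to89.B8SockHFP59GammaTraceFree
import Literature.MathematicalPhysics.QuantumFieldTheory.Balaban1983to89.B8Prop5KLevelLettersG
import Literature.MathematicalPhysics.QuantumFieldTheory.Balaban1983to89.B8CubeMemberLamBPrimeLaws
import Literature.MathematicalPhysics.QuantumFieldTheory.Balaban1983to89.B8LeafKnitZd3CubBdryBeta
import Literature.MathematicalPhysics.QuantumFieldTheory.Balaban1983to89.B8Ineq133CubeMemberGamma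
import HarnessLib

/-!
# `hP1room` PROGRAMME — EDITION γ, v9 «hT4TLγ-REDUCE-γ + SLetτ-DISCHARGE» (LEAD-H ★w5-19200 g7 WORDS 12∕14∕15; px10 g3 LOCATE (L-B) 125947dd), FILE (3a′):
# ★★ THEOREM 4's RAW PROPOSITION-5 BASE SOCKET `hP5baseγ` IN `G`-FORM WITH SUPPORT AT N05's CUBE MEMBER OF RECORD, FLAT BACKGROUND, FROM THE [4] LETTERS (+ `τ`-laws)
# AT TRUNCATION `1` — the γ twin of ✓`HalvingHSiteRawP5BaseOfLeaf.rawP5base_of_lettersτ_cubeMember` (v6 FILE A′)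

Route `UnitScaleTilt`, crux K1 child «MinimiserStabilityRegPr» (stmt-QuantumFields-19200), registered stub `stub_halvingStep` (`BirthV10`).  Cell `ym3-torus` (HUMAN RULING
D-0037: YM₃ on T³ is ladder rung R3 — NOT d = 4, NOT a mass gap, NOT the Clay problem), width seat `ym3-torus-px9` gen 5 (LEAD-H WORD 15 «v9 (3) LEAF FILES → px9 g5»).
`--supports stmt-QuantumFields-19200 --as helper`; THEOREMS ONLY (0 `def`, 0 `sorry`); count-neutral; nothing here claims `hT4Tγ`, `hT4TLγ`, `hSupUρ5`, the stub, the crux or the gap.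

WHY (LEAD-H WORDS 12∕14: v9).  px3 g4's FILE (2) `hT4Tγ_of_rawSocketsγ` reduces the guarded Theorem-4 socket with support clause `hT4Tγ` to THREE raw γ-sockets `hP5baseγ hP5γ H59γ`
(∀ `gJ`-closed under J3's guards); its `hP5baseγ` is lit ✓`B8Prop5KLevelLettersG.hP5base_of_HFP_mem`'s conclusion at the member — the v6 base socket PLUS THE SUPPORT CLAUSE
`v = 1` off `□₀`.  ★★ `rawP5baseγ_of_lettersτ_cubeMember` — v6 ✓`rawP5base_of_lettersτ_cubeMember` VERBATIM (generic C⋆-algebra `𝔸`, groups `G ≤ H`, N05's cube member of record,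
flat background `U₀ := 1`, `G`-valued pre-gauged `U′` with J3's (1.34)-𝔄 and axial rows and the fine row on the collar at depth `k`; base datum `A₀ := (iη)⁻¹ log U′` by lit
✓`base_datum`, `τ(A₀) = 0` by (H2); the [4] letters `SLetτ` at truncation `1` and the JOIN's window conjunction `hwin` EXACTLY as v6 — `SLetτ` is a THEOREM on print's sub-lattice,
✓`HalvingSLetTauFlatCubeMember.sLetτAll_flat_cubeMember_printed` p689656; lit ✓`sockHFP₀_body_of_join_RD_traceFree` at the member — the base join reads NO (1.59), so edition γ
changes nothing here but the target letter), with: the b9 socket `SB9all` DROPPED (unused by the base), and the `G`-form adapter now lit ✓`hP5_step_of_HFP_mem` (pub-ymgap F4a),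
which exports the support clause from the join's `λ = 0` off `Ω₀`.  Conclusion = lit ✓`hP5base_of_HFP_mem`'s ∃(v, λ)-body at `α₄ := 8B₀′c⋆`, `c⋆ := 5dLB₀(α₀ + α₁)`.
HONEST SCOPE.  By-name plumbing over landed lit theorems; the letters and windows are DISPLAYED hypotheses here; nothing of [4], Prop. 3 ∕ 5, Theorem 4, `hT4Tγ` or the stub is
proved here.  Rung R3 (YM₃ on T³), NOT Clay; YM gap NOT proved.

References: T. Bałaban, CMP **99** (1985) 75–102 [Balaban1985RegularSpaces] (Prop. 5 (1.106)–(1.109) p.94, p.89, Thm 4 p.88, (1.66) p.87, (1.29) p.81, (1.38) p.82, (1.131) p.99,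
p.98, p.76); CMP **99** (1985) 389–434 [Balaban1985BackgroundPropagators] (Thm 3.1 p.397, (3.25) p.394, Thm 3.3 p.398); CMP **98** (1985) 17–51 [Balaban1985Averaging] ((43) p.24).
-/

set_option autoImplicit false

noncomputable section

open scoped BigOperators
open NormedSpace
open Complex (I)

namespace Summit.QuantumFields.YangMills.Theorems.HalvingHSiteRawP5BaseGammaOfLeaf

open Literature.MathematicalPhysics.QuantumFieldTheory.Balaban1983to89
open MatrixLog (mlog)
open B7Prop1Explicit (e expUnit U1 Site)
open B7Prop2Explicit (unitaryUnits unitaryUnits_le_U1 C0 c2' avgIter AvgClosed)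
open B7Prop3Flat (c3)
open B7Prop10General (C6 C4G)
open B7Prop9Flat (C5')
open B7Prop1Local (InBox loK bondHiK)
open B7Eq78Linearization (conjR zdBlocking QprimeIter)
open B7Eq92Concrete (mgauge mgauge_apply Rc Rc_apply)
open B8Ineq130 (tlo thi)
open B8Ineq132 (covDerivFwd covDeriv InAk BondTouches)
open B8Eq119TwistedAxial (Restr129 InAx bgT)
open B8Eq184Proof (gaugeExp cfgExp)
open B8Eq182Proof (gAd)
open B8Eq188Proof (frakF3)
open B8Lemma1NonAbelian (mulCfg)
open B8Eq140Level (SideTouches)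
open B8Eq146AExpansion (iEta)
open B8Eq138LandauZd (IsLandau138W covDivB covLap QT isLandau138W_congr)
open B7Prop4GeneralLevels (linCovIter)
open B8Eq155JBound (Jcur wsup)
open B8ScaledSupNorm (bondNorm msup)
open B8Ineq125Concrete (C2p)
open B8Eq1117Concrete (XSpace)
open B8Prop5ContractionKLevel (Bd2 Mc Kc)
open B8LambdaSpaceKLevel (wt)
open B8Prop6OfThm4 (one_inAk)
open B8Eq131Cubes (tLo tHi collar_cube)
open B8Eq131CubesAdmissible (cubeFam cubeFam_false_of_le)
open B8CubeMemberZd (cubeLamS cubeLamB hΩ_cubeFam)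
open B9SupplySockB9P3ZdBeta (CrossB)
open B9SupplySockB9P3ZdGamma (cubeLamBP')
open B8CubeMemberLamBPrimeLaws (cubeLamBP'_hbox_pred cubeLamBP'_hclass)
open B8LeafKnitZd3CubBdryBeta (bdryLayer_cubeMember)
open B8Ineq133CubeMemberGamma (ends_inBox_tilde_of_bondBox_subset_tcube bondBox_subset_tcube_of_subset_cubeFam)
open B8SockHFPCubeMember (htw_cubeLamS h8lt_cubeLamS h8top_cubeLamS)
open B8SockHFPTraceFree (sockHFP₀_body_of_join_RD_traceFree)
open B8SockHFP59GammaTraceFree (sockHFP_body_of_join_59_γ_traceFree)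
open B8SockHFPTorusTraceFree (apply_eq_zero_of_cfgExp_mem)
open B8Prop5KLevelLettersG (hP5_step_of_HFP_mem)
open B8Thm4TruncationLocal (base_datum)
open HalvingP1FlatCoreSupplierInduction (h34_of_inAk_univ hAx_of_inAx_one ends_of_sideTouches)

variable {d : ℕ} {𝔸 : Type*} [CStarAlgebra 𝔸] [Nontrivial 𝔸]

/-! ## §1 The raw BASE socket `hP5baseγ` (level `0 → 1`) with support, from the letters at truncation `1` -/

set_option maxHeartbeats 400000 in
/-- ★★ **THE RAW PROPOSITION-5 BASE SOCKET IN `G`-FORM WITH SUPPORT, AT N05's CUBE MEMBER OF RECORD AND THE FLAT BACKGROUND, FROM THE [4] LETTERS AT TRUNCATION `1`** —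
v6 ✓`rawP5base_of_lettersτ_cubeMember` VERBATIM (base datum `A₀ := (iη)⁻¹ log U′` by lit ✓`base_datum` from the fine row on the collar `□̃` at depth `k`, `τ(A₀) = 0` by (H2);
lit ✓`sockHFP₀_body_of_join_RD_traceFree` at the member) with the b9 socket dropped and the SUPPORT clause `v = 1` off `□₀` exported through lit ✓`hP5_step_of_HFP_mem`;
conclusion = lit ✓`hP5base_of_HFP_mem`'s ∃(v, λ)-body (`α₄ := 8B₀′c⋆`, `c⋆ := 5dLB₀(α₀ + α₁)`).
[cite: Balaban1985RegularSpaces, Prop. 5 (1.106)-(1.109) p.94, p.89, Thm 4 p.88, (1.66) p.87, (1.29) p.81, (1.38) p.82, (1.131) p.99, p.98, p.76; Balaban1985BackgroundPropagators, Thm 3.1 p.397, (3.25) p.394; Balaban1985Averaging, (43) p.24] -/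
theorem rawP5baseγ_of_lettersτ_cubeMember (τ : 𝔸 →L[ℂ] ℂ) (hτ : ∀ x y : 𝔸, τ (x * y) = τ (y * x)) (hd2 : 2 ≤ d) {L : ℕ} (hL : 2 ≤ L) {η : ℝ} (hη : 0 < η)
    {k : ℕ} (hk : 1 ≤ k)
    -- the groups of the joint J-SU: `G` (averaging-closed, unitary; `1, U′, u₁ ∈ G`) `≤ H` ((H2), (H3)), and (G3) `e^{iλ} ∈ G` for Hermitian `τ`-free `λ`
    -- (at `M₂(ℂ)`: `SU(2) ≤ SL(2, ℂ)` by lit ✓`B8SpecialLinearTrace`, (G3) by lit ✓`B8SpecialUnitaryTrace.gaugeExp_mem_specialUnitaryUnits`)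
    {G H : Subgroup 𝔸ˣ} (hGrp2 : ∀ g ∈ H, ‖(g : 𝔸) - 1‖ ≤ 1 / 8 → τ (mlog (g : 𝔸)) = 0) (hGrp3 : ∀ S : 𝔸, τ S = 0 → expUnit S ∈ H)
    (hGA : AvgClosed d L G) (hGH : G ≤ H) (hGu : G ≤ unitaryUnits 𝔸)
    (hG3 : ∀ lam : Site d → 𝔸, (∀ x, IsSelfAdjoint (lam x)) → (∀ x, τ (lam x) = 0) → ∀ x, gaugeExp lam x ∈ G)
    -- N05's cube member OF RECORD `Ω_j := □_j = cubeFam false L a M ρ k j` with its tower families (lit `B8CubeMemberZd`; defining equations, callers write `rfl`)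
    (aC : Site d) (M : ℕ) {ρ : ℕ} (hρ : L ≤ ρ)
    {Ω : ℕ → Set (Site d)} (hΩdef : Ω = cubeFam false L aC M ρ k)
    {Λs : ℕ → ℕ → Set (Site d)} (hΛsdef : Λs = cubeLamS L aC M ρ k)
    -- the constants and the pre-gauged field `U′` of J3 (`G`-valued), with J3's rows: (1.34)-𝔄 on `ℤᵈ`, axial at the flat background for every family (the base reads no (1.35))
    {α₀ α₁ B₀ B₀' : ℝ} (hα₀ : 0 < α₀) (hα₁ : 0 < α₁) (hB₀ : 0 < B₀) (hB₀' : 0 < B₀')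
    {U' : Site d → Fin d → 𝔸ˣ} (hU'G : ∀ x κ, U' x κ ∈ G)
    (hInAk : InAk L k η α₀ (fun _ => (Set.univ : Set (Site d))) U')
    (hAxJ : ∀ m', m' ≤ k → ∀ Λ : ℕ → Set (Site d), InAx L m' Λ (1 : Site d → Fin d → 𝔸ˣ) U')
    -- (the JOIN's window conjunction below keeps its two b9 letters `cB9`, unused in edition γ, so that lit ✓`hfpWindows_of_guard` feeds it verbatim)
    {cB9 : ℝ}
    -- the base datum's nearness letter `a` (Theorem 4's (1.66) `|U′ − 1| ≤ a` on the collar `□̃` at depth `k`, `2a ≤ c⋆` — ✓p654692's `hfine`∕`ha2`; at the member `a := s`)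
    {a : ℝ} (ha2 : 2 * a ≤ 5 * (d : ℝ) * L * B₀ * (α₀ + α₁))
    (hfine : ∀ (x : Site d) (ν : Fin d), tlo L (tLo aC ρ) k ≤ x → x + e ν ≤ thi L (tHi aC M ρ) k → ‖((U' x ν : 𝔸ˣ) : 𝔸) - 1‖ < a)
    -- the [4] LETTERS AT EVERY TRUNCATION `n ≤ k` AT THE FLAT BACKGROUND, AS ONE ∃-PACKAGE PER `n`: lit `SockLettersRD`'s body at `(α₀, U₀ := 1, n)` ∧ lit `LettersTau`'s three
    -- fields (the shape of ✓p654110's `SLetτ`, there at `n := m + 1` only) — [4] Thm 3.1 ∕ (3.25) for Bałaban's operators `G Δ Q Q* A C H′` on the member's cube families (N05∕N06)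
    {B₀'H B₂' BG BR : ℝ} (hB₀'H : 0 < B₀'H) (hB₂' : 0 ≤ B₂') (hBG : 0 ≤ BG) (hBR : 0 ≤ BR)
    (SLetτ : ∀ n, 1 ≤ n → n ≤ k → ∃ (g Δ : (Site d → 𝔸) →ₗ[ℂ] (Site d → 𝔸)) (q : (Site d → 𝔸) →ₗ[ℂ] (ℕ → Site d → 𝔸))
        (qs : (ℕ → Site d → 𝔸) →ₗ[ℂ] (Site d → 𝔸)) (Aw c : (ℕ → Site d → 𝔸) →ₗ[ℂ] (ℕ → Site d → 𝔸)) (H' : XSpace d n 𝔸 →ₗ[ℂ] (Site d → 𝔸)),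
      (∀ x, ∀ y ∈ Ω 0, (Δ (g x) + qs (Aw (q (g x)))) y = x y) ∧ (∀ f, q (g (g (qs (c (q f))))) = q f) ∧
      (∀ (f : Site d → 𝔸), ∀ x ∈ Ω 0, Δ f x = covLap η (1 : Site d → Fin d → 𝔸ˣ) ((Ω 0).indicator f) x) ∧
      (∀ (μ : ℕ → Site d → 𝔸), ∀ x ∈ Ω 0, qs μ x = QT L n (Λs n) (1 : Site d → Fin d → 𝔸ˣ) μ x) ∧
      (∀ (f : Site d → 𝔸) (j : ℕ), j ≤ n → ∀ y ∈ Λs n j, q f j y = QprimeIter (zdBlocking d L) (bgT L (1 : Site d → Fin d → 𝔸ˣ)) j f y) ∧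
      (∀ (X : XSpace d n 𝔸) (x : Site d), ‖H' X x‖ ≤ B₀'H * ‖X‖) ∧
      (∀ j, j ≤ n → ∀ (X : XSpace d n 𝔸), ∀ p ∈ {b : Site d × Fin d | SideTouches (Ω j) b.1 b.2},
        wt L η j * ‖covDerivFwd η (1 : Site d → Fin d → 𝔸ˣ) p.2 (H' X) p.1‖ ≤ B₀'H * ‖X‖) ∧
      (∀ X : XSpace d n 𝔸, Bd2 L η n Ω (covLap η (1 : Site d → Fin d → 𝔸ˣ) (H' X)) (B₂' * ‖X‖)) ∧
      (∀ (X : XSpace d n 𝔸) (x : Site d), x ∉ Ω 0 → H' X x = 0) ∧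
      (∀ X Y : XSpace d n 𝔸, (∀ p, Y p = -star (X p)) → ∀ x, H' Y x = -star (H' X x)) ∧
      (∀ (Y : XSpace d n 𝔸) (j : ℕ) (hj : j ≤ n) (y : Site d), y ∈ Λs n j →
        QprimeIter (zdBlocking d L) (bgT L (1 : Site d → Fin d → 𝔸ˣ)) j (H' Y) y = Y (⟨j, Nat.lt_succ_of_le hj⟩, y)) ∧
      (∀ (f : Site d → 𝔸) (r : ℝ), 0 ≤ r → Bd2 L η n Ω f r →
        (∀ x, ‖g f x‖ ≤ BG * r) ∧ ∀ j, j ≤ n → ∀ p ∈ {b : Site d × Fin d | SideTouches (Ω j) b.1 b.2},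
          wt L η j * ‖covDerivFwd η (1 : Site d → Fin d → 𝔸ˣ) p.2 (g f) p.1‖ ≤ BG * r) ∧
      (∀ (f : Site d → 𝔸) (x : Site d), x ∉ Ω 0 → g f x = 0) ∧
      (∀ f : Site d → 𝔸, (∀ j, j ≤ n → ∀ x ∈ Ω j, IsSelfAdjoint (f x)) → ∀ x, IsSelfAdjoint (g f x)) ∧
      (∀ (f : Site d → 𝔸) (r : ℝ), 0 ≤ r → Bd2 L η n Ω f r → Bd2 L η n Ω (f - g (qs (c (q (g f))))) (BR * r)) ∧
      (∀ f : Site d → 𝔸, (∀ j, j ≤ n → ∀ x ∈ Ω j, IsSelfAdjoint (f x)) → ∀ j, j ≤ n → ∀ x ∈ Ω j, IsSelfAdjoint ((f - g (qs (c (q (g f))))) x)) ∧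
      (∀ X : XSpace d n 𝔸, (∀ p, τ (X p) = 0) → ∀ x, τ (H' X x) = 0) ∧
      (∀ f : Site d → 𝔸, (∀ j, j ≤ n → ∀ x ∈ Ω j, τ (f x) = 0) → ∀ x, τ (g f x) = 0) ∧
      (∀ f : Site d → 𝔸, (∀ j, j ≤ n → ∀ x ∈ Ω j, τ (f x) = 0) → ∀ j, j ≤ n → ∀ x ∈ Ω j, τ ((f - g (qs (c (q (g f))))) x) = 0))
    -- the JOIN's scalar windows at this `(α₀, α₁)` AS ONE CONJUNCTION — letter for letter the conclusion of lit ✓`B8SockHFPWindows.hfpWindows_of_guard` (= the `hwin` of lit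
    -- ✓`B8SockHFPTorusTraceFree.sockHFPτ_family_of_lettersAt`): Prop. 3's four, the b9 thresholds, the Sect. D∕E JOIN's, at `c⋆ = 5dLB₀(α₀ + α₁)`, `α₄ = 8B₀′c⋆`, `cB = cA = L·c⋆`, `cDA = 2dL²·c⋆`
    (hwin : ∀ cs α₄ cB cDA hE hE₂ lE lE₂ : ℝ, cs = 5 * (d : ℝ) * L * B₀ * (α₀ + α₁) → α₄ = 8 * B₀' * (5 * (d : ℝ) * L * B₀) * (α₀ + α₁) →
      cB = L * cs → cDA = 2 * (d : ℝ) * (L : ℝ) ^ 2 * cs →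
      hE = B₀'H * (C2p d * (40 * d * cB + α₄) * α₄) → hE₂ = B₂' * (C2p d * (40 * d * cB + α₄) * α₄) →
      lE = B₀'H * (4 * C2p d * (40 * d * cB + 2 * α₄)) → lE₂ = B₂' * (4 * C2p d * (40 * d * cB + 2 * α₄)) →
      36 * d * B₀ * cs ≤ 1 / 2 ∧
      8 * (131072 * ((d : ℝ) + 1) ^ 2) * Real.exp (4 * (800 * ((d : ℝ) + 1) ^ 2 * ((d : ℝ) + 4)) * α₀) ≤ 16 * (131072 * ((d : ℝ) + 1) ^ 2) ∧
      2 * cs ^ 2 + 20 * d * α₀ * cs + 2 * (16 * (131072 * ((d : ℝ) + 1) ^ 2)) * cs ^ 2 ≤ α₀ + α₁ ∧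
      (d : ℝ) * L * α₁ ≤ 1 / 8 ∧
      α₀ ≤ cB9 ∧ cs ≤ cB9 ∧
      C0 d * α₀ ≤ 1 / 3 ∧ 4 * α₀ ≤ c2' d L ∧
      Real.exp (4 * (800 * ((d : ℝ) + 1) ^ 2 * ((d : ℝ) + 4)) * α₀) * (1 + 8 * (131072 * ((d : ℝ) + 1) ^ 2) * cB) ≤ 2 ∧
      2 * cB ≤ c3 d L ∧ 2048 * (d : ℝ) * cB ≤ 1 ∧ 40 * d * cB ≤ 1 / 200 ∧
      200 * C6 d * (2 * α₄) ≤ 1 ∧ 12000 * ((d : ℝ) + 1) * L * (2 * α₄) ≤ 1 ∧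
      C4G d L * (α₀ + 40 * d * cB + 4 * (2 * α₄)) ≤ 1 ∧
      1024 * ((d : ℝ) + 1) * ((d : ℝ) + 4) * L ^ 2 * α₀ ≤ 1 ∧ 32 * ((d : ℝ) + 1) ^ 2 * C6 d * L ^ 2 * α₀ ≤ 1 ∧
      16 * d * C5' d * C6 d * (L : ℝ) ^ 2 * α₀ ≤ 1 ∧ 8 * d * C6 d * L * α₀ ≤ 1 ∧
      40 * d * cB + α₄ ≤ 1 / (4 * B₀'H * (2 * C2p d)) ∧ 2 * C6 d * (40 * d * cB + 4 * α₄) ≤ 1 / 8 ∧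
      cB ≤ 1 / 13 ∧ α₄ / 4 + hE ≤ 1 / 24 ∧ α₄ / 4 + hE ≤ 1 / 140 ∧ 10 * (α₄ / 4 + hE) * BR ≤ 1 / 2 ∧
      BG * Mc d BR (α₄ / 4 + hE) cB hE₂ cDA ≤ α₄ / 4 ∧
      BG * Kc d BR (α₄ / 4 + hE) cB hE₂ cDA lE₂ (1 + lE) (1 + lE) ≤ 1 / 2) :
    ∃ (v : Site d → 𝔸ˣ) (lam : Site d → 𝔸), (∀ x, v x ∈ G) ∧ (∀ x, x ∉ Ω 0 → v x = 1) ∧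
      (∀ j, j ≤ 1 → ∀ b ∈ {b : Site d × Fin d | SideTouches (Ω j) b.1 b.2}, (v b.1 : 𝔸) = ((gaugeExp lam b.1 : 𝔸ˣ) : 𝔸) ∧
        (v (b.1 + e b.2) : 𝔸) = ((gaugeExp lam (b.1 + e b.2) : 𝔸ˣ) : 𝔸)) ∧
      (∀ j, j ≤ 1 → ∀ b ∈ {b : Site d × Fin d | SideTouches (Ω j) b.1 b.2},
        ‖lam b.1‖ ≤ 8 * B₀' * (5 * (d : ℝ) * L * B₀) * (α₀ + α₁) ∧
          ((L : ℝ) ^ j * η) * ‖covDerivFwd η (1 : Site d → Fin d → 𝔸ˣ) b.2 lam b.1‖ ≤ 8 * B₀' * (5 * (d : ℝ) * L * B₀) * (α₀ + α₁)) ∧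
      IsLandau138W L 1 η (Ω 0) (Λs 1) (1 : Site d → Fin d → 𝔸ˣ) (mgauge (1 : Site d → Fin d → 𝔸ˣ) v⁻¹ U') ∧
      Restr129 L 1 (Λs 1) (1 : Site d → Fin d → 𝔸ˣ) ((1 : Site d → 𝔸ˣ) * v) := by
  subst hΩdef hΛsdef
  have hL1 : 1 ≤ L := le_trans (by norm_num) hL
  have hLr : (1 : ℝ) ≤ L := by exact_mod_cast hL1
  have hρ1 : 1 ≤ ρ := hL1.trans hρ
  -- the windows at this `(α₀, α₁)`
  obtain ⟨hside, hC₂, h61, hsmall₁, hα₀9, hcs9, hα3, hα4, hsmall, hc₃, hsc, hα₃', hs₁, hs₂, hs₃, hs₄, hs₅, hs₆, hs₇, hsm, hprod8, hcA', ha₁',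
    hb₁', hθ, h103, h106⟩ := hwin _ _ _ _ _ _ _ _ rfl rfl rfl rfl rfl rfl rfl rfl
  have hsum : 0 < α₀ + α₁ := add_pos hα₀ hα₁
  have hcs0 : 0 ≤ 5 * (d : ℝ) * L * B₀ * (α₀ + α₁) := by positivity
  -- `c⋆ ≤ 1∕8000` (hence `16c⋆ ≤ 1`, `c⋆ ≤ 1∕12`), `α₄ ≤ 1∕84`, `2α₁ ≤ c⋆`, `α₁ ≤ ¼` from the windows and `2 ≤ 5dLB₀`
  have h16 : 16 * (5 * (d : ℝ) * L * B₀ * (α₀ + α₁)) ≤ 1 := by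
    have hd0 : (1 : ℝ) ≤ d := by exact_mod_cast (show 1 ≤ d by omega)
    have hcsB : 5 * (d : ℝ) * L * B₀ * (α₀ + α₁) ≤ L * (5 * (d : ℝ) * L * B₀ * (α₀ + α₁)) := le_mul_of_one_le_left hcs0 hLr
    have hcBsmall : (d : ℝ) * (L * (5 * (d : ℝ) * L * B₀ * (α₀ + α₁))) ≤ 1 / 8000 := by linarith only [hα₃']
    have h1 : 5 * (d : ℝ) * L * B₀ * (α₀ + α₁) ≤ 1 / 8000 :=
      ((le_mul_of_one_le_left hcs0 hd0).trans (mul_le_mul_of_nonneg_left hcsB (by positivity))).trans hcBsmall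
    linarith only [h1]
  have hcs12 : 5 * (d : ℝ) * L * B₀ * (α₀ + α₁) ≤ 1 / 12 := by linarith only [h16, hcs0]
  have hα84 : 8 * B₀' * (5 * (d : ℝ) * L * B₀) * (α₀ + α₁) ≤ 1 / 84 := by
    have hC6 : (2 : ℝ) ≤ C6 d := B7ConclGaugeLin.two_le_C6'
    have hα₄0 : 0 ≤ 8 * B₀' * (5 * (d : ℝ) * L * B₀) * (α₀ + α₁) := by positivity
    have h := mul_le_mul_of_nonneg_right hC6 (by positivity : (0 : ℝ) ≤ 200 * (2 * (8 * B₀' * (5 * (d : ℝ) * L * B₀) * (α₀ + α₁))))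
    nlinarith only [hs₁, h, hα₄0]
  have ha4 : a ≤ 1 / 4 := by linarith only [ha2, hcs12]
  have ha8 : a ≤ 1 / 8 := by linarith only [ha2, h16, hcs0]
  -- the member geometry (lit `B8CubeMemberZd` ∕ `B8SockHFPCubeMember`, BY NAME)
  have hΩ := hΩ_cubeFam (d := d) hL1 aC M hρ k
  have htower := htw_cubeLamS (d := d) hL1 aC M ρ k 1 hk
  -- the pre-gauged field's rows at the flat background
  have h33 : InAk L k η α₀ (cubeFam false L aC M ρ k) (1 : Site d → Fin d → 𝔸ˣ) := one_inAk hL1 k hη hα₀ _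
  have h34 := h34_of_inAk_univ hInAk (cubeFam false L aC M ρ k)
  have hAx := hAx_of_inAx_one hAxJ (cubeLamS L aC M ρ k)
  -- group data
  have h1G : ∀ (x : Site d) (κ : Fin d), (1 : Site d → Fin d → 𝔸ˣ) x κ ∈ G := fun _ _ => G.one_mem
  have hU' : ∀ x κ, U' x κ ∈ unitaryUnits 𝔸 := fun x κ => hGu (hU'G x κ)
  -- (1.66) on the sides touching `□₀`, read off the fine row on the collar `□̃` at depth `k`
  have h66 : ∀ b ∈ {b : Site d × Fin d | SideTouches (cubeFam false L aC M ρ k 0) b.1 b.2}, ‖((U' b.1 b.2 : 𝔸ˣ) : 𝔸) - 1‖ ≤ a := by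
    intro b hb
    have hb' : SideTouches (cubeFam false L aC M ρ k 0) b.1 b.2 := hb
    rw [cubeFam_false_of_le L aC M ρ (Nat.zero_le k)] at hb'
    obtain ⟨h1, h2⟩ := ends_of_sideTouches (collar_cube hL hρ1 (Nat.zero_le k)) hb'
    exact (hfine b.1 b.2 h1 h2).le
  -- the base datum `A₀ := (iη)⁻¹ log U′` (lit ✓`base_datum`): chart, Hermitian, `|A₀| ≤ 2aη⁻¹ ≤ c⋆η⁻¹`; `τ`-free by (H2)
  have hdat : ∀ j, j ≤ 0 → ∀ b ∈ {b : Site d × Fin d | SideTouches (cubeFam false L aC M ρ k j) b.1 b.2},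
      U' b.1 b.2 = cfgExp η (fun y μ => η⁻¹ • ((I⁻¹ : ℂ) • mlog ((U' y μ : 𝔸ˣ) : 𝔸))) b.1 b.2 ∧
        IsSelfAdjoint ((fun y μ => η⁻¹ • ((I⁻¹ : ℂ) • mlog ((U' y μ : 𝔸ˣ) : 𝔸))) b.1 b.2) ∧
        ‖(fun y μ => η⁻¹ • ((I⁻¹ : ℂ) • mlog ((U' y μ : 𝔸ˣ) : 𝔸))) b.1 b.2‖ ≤ (5 * (d : ℝ) * L * B₀ * (α₀ + α₁)) * ((L : ℝ) ^ j * η)⁻¹ := by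
    intro j hj b hb
    obtain rfl : j = 0 := Nat.le_zero.mp hj
    obtain ⟨-, hexp, hsa, hn⟩ := base_datum hη (1 : Site d → Fin d → 𝔸ˣ) U' hU' ha4 b.1 b.2 (h66 b hb)
    refine ⟨hexp, hsa, hn.trans ?_⟩
    rw [pow_zero, one_mul]
    exact mul_le_mul_of_nonneg_right ha2 (inv_nonneg.mpr hη.le)
  have hAτ : ∀ j, j ≤ 0 → ∀ b ∈ {b : Site d × Fin d | SideTouches (cubeFam false L aC M ρ k j) b.1 b.2},
      τ ((fun y μ => η⁻¹ • ((I⁻¹ : ℂ) • mlog ((U' y μ : 𝔸ˣ) : 𝔸))) b.1 b.2) = 0 := by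
    intro j hj b hb
    obtain rfl : j = 0 := Nat.le_zero.mp hj
    have h0 : τ (mlog ((U' b.1 b.2 : 𝔸ˣ) : 𝔸)) = 0 := hGrp2 _ (hGH (hU'G b.1 b.2)) ((h66 b hb).trans ha8)
    show τ (η⁻¹ • ((I⁻¹ : ℂ) • mlog ((U' b.1 b.2 : 𝔸ˣ) : 𝔸))) = 0
    rw [RCLike.real_smul_eq_coe_smul (K := ℂ), map_smul, map_smul, h0, smul_zero, smul_zero]
  -- the letters at truncation `1` with their `τ`-laws
  obtain ⟨g, Δ, q, qs, Aw, c, H', g_rightΩ, c_range, hΔ, hqs, hq, hH0, hH1, hH2, hHsupp, hHequiv, hQH, hG, hGsupp, hGreal, hRbd, hRreal, hHτ, hGτ, hRτ⟩ :=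
    SLetτ 1 le_rfl hk
  -- THE `τ`-FREE BASE JOIN (lit, BY NAME) at the member
  obtain ⟨lam, hlsa, hloff, hlτ, h108, hmul, h129'⟩ := sockHFP₀_body_of_join_RD_traceFree τ hτ hd2 hL hη hk hGrp2 hGrp3 hGA hGH hGu hΩ htower hα₀ hα₁ hB₀ hB₀'
    rfl rfl h1G h33 h34 hAx hdat hAτ g Δ q qs Aw c g_rightΩ c_range hΔ hqs hq H' hB₀'H hB₂' hBG hBR hH0 hH1 hH2 hHsupp hHequiv hQH hG hGsupp hGreal hRbd
    hRreal hHτ hGτ hRτ le_rfl le_rfl le_rfl hα3 hα4 hsmall hc₃ hsc hα₃' hs₁ hs₂ hs₃ hs₄ hs₅ hs₆ hs₇ hsm hprod8 rfl rfl rfl rfl hcA' ha₁' hb₁' hθ h103 h106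
  -- lit's `G`-form step adapter WITH SUPPORT (F4a ✓`hP5_step_of_HFP_mem`) at `m = 0`, `u₁ = 1`, `U₁ = U′`, with (G3)
  have h1u : ∀ (x : Site d) (κ : Fin d), (1 : Site d → Fin d → 𝔸ˣ) x κ ∈ unitaryUnits 𝔸 := fun _ _ => (unitaryUnits 𝔸).one_mem
  exact hP5_step_of_HFP_mem hd2 hη L 0 h1u hα84 hcs12 _ _ 1 U' _ hdat ⟨lam, hlsa, hloff, hG3 lam hlsa hlτ, h108, hmul, h129'⟩

end Summit.QuantumFields.YangMills.Theorems.HalvingHSiteRawP5BaseGammaOfLeaf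

end
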